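import Summits.HubbardSuperconductivity.HubbardSuperconductivity.Theorems.AnisotropyChordTransferFibre3KernelHarmonicity

/-!
# Route `AnisotropyChord` / H0 rotor rung: reductions of cos-weighted one-propagator sums (PartN41-B §4 content)

Theory-1 g22's PartN41-B §4 (`EnergyTimesPropagator`, `CosWeightedReduction`): with `g = gres L λ₂`, `E = 2ε_T`,
`S_j = Σ_k g(k)^j`:  `E g = 1 + λ₂ g` off `k = 0`, and by the `x ↔ y` symmetry of `g` together with
`cos kₓ + cos k_y = 2 − ε_T(k)`:
★ `sum_gpow_cos_eq`: `Σ_k g^j cos kₓ = (1 − λ₂/4)·S_j − S_{j−1}′/4` where `S_{j−1}′ = Σ_{k≠0} g^{j−1}` (`= S_{j−1}` for `j ≥ 2`,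
`= V − 1` for `j = 1`).  Stated with plain sums over `Tor L` (the named-sum spellings `S1n … S4n = B1.torSum …` of the statement
file are bridged after its port).
Prover seat `hubbard-h0-rotor-p1` g26; helper for stmt-HubbardSuperconductivity-23918 (`--supports`, helper class).
WHAT THIS IS NOT: nothing here proves superconductivity in the Hubbard model; bookkeeping identities of ONE row of ONE conditional reduction.
Tree imports only; no new definitions; no sorry, no axioms.
-/

set_option linter.dupNamespace false
set_option autoImplicit false

noncomputable section

open scoped BigOperators

namespace Summit.HubbardSuperconductivity.HubbardSuperconductivity.Theorems.AnisotropyChord.Transfer.Fibre3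

namespace KT1Assembly

variable (L : ℕ) [NeZero L]

omit [NeZero L] in
/-- `E(k)·g(k) = 1 + λ₂ g(k)` for `k ≠ 0` with `2ε(k) ≠ λ₂`. [folklore] -/
theorem two_epsT_mul_gres (lam2 : ℝ) (k : Tor L) (hk : k ≠ 0) (hne : 2 * epsT L k - lam2 ≠ 0) :
    2 * epsT L k * gres L lam2 k = 1 + lam2 * gres L lam2 k := by
  unfold gres
  rw [if_neg hk]
  field_simp
  ring

/-- `x ↔ y` symmetry of the cos-weighted power sums: `Σ g^j cos kₓ = Σ g^j cos k_y`. [folklore] -/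
theorem sum_gpow_cos_swap (lam2 : ℝ) (j : ℕ) :
    ∑ k : Tor L, gres L lam2 k ^ j * Real.cos (2 * Real.pi * k.1.val / L)
      = ∑ k : Tor L, gres L lam2 k ^ j * Real.cos (2 * Real.pi * k.2.val / L) := by
  refine Fintype.sum_equiv (Equiv.prodComm (ZMod L) (ZMod L)) _ _ fun k => ?_
  simp only [Equiv.prodComm_apply, Prod.swap]
  have hg : gres L lam2 (k.2, k.1) = gres L lam2 k := by
    unfold gres
    have : ((k.2, k.1) : Tor L) = 0 ↔ k = 0 := by
      constructor
      · intro h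
        have h1 := congrArg Prod.fst h; have h2 := congrArg Prod.snd h
        simp only [Prod.fst_zero, Prod.snd_zero] at h1 h2
        exact Prod.ext h2 h1
      · intro h; rw [h]; rfl
    simp only [this, epsT_swap]
  rw [hg]

omit [NeZero L] in
/-- `cos kₓ + cos k_y = 2 − ε_T(k)`. [folklore] -/
theorem cos_add_cos_eq (k : Tor L) :
    Real.cos (2 * Real.pi * k.1.val / L) + Real.cos (2 * Real.pi * k.2.val / L) = 2 - epsT L k := by
  unfold epsT; ring

/-- ★ COS-WEIGHTED REDUCTION: for `j ≥ 1`, if `2ε(k) ≠ λ₂` off `k = 0`,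
`Σ_k g^j cos kₓ = (1 − λ₂/4)·Σ_k g^j − (1/4)·Σ_{k≠0} g^{j−1}`. [folklore] -/
theorem sum_gpow_cos_eq (lam2 : ℝ) (j : ℕ) (hj : 1 ≤ j) (hne : ∀ k : Tor L, k ≠ 0 → 2 * epsT L k - lam2 ≠ 0) :
    ∑ k : Tor L, gres L lam2 k ^ j * Real.cos (2 * Real.pi * k.1.val / L)
      = (1 - lam2 / 4) * (∑ k : Tor L, gres L lam2 k ^ j)
        - (1 / 4) * ∑ k ∈ (Finset.univ : Finset (Tor L)).erase 0, gres L lam2 k ^ (j - 1) := by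
  classical
  -- symmetrise
  have hsym := sum_gpow_cos_swap L lam2 j
  have hadd : (∑ k : Tor L, gres L lam2 k ^ j * Real.cos (2 * Real.pi * k.1.val / L))
      + (∑ k : Tor L, gres L lam2 k ^ j * Real.cos (2 * Real.pi * k.2.val / L))
      = ∑ k : Tor L, gres L lam2 k ^ j * (2 - epsT L k) := by
    rw [← Finset.sum_add_distrib]
    refine Finset.sum_congr rfl (fun k _ => ?_)
    rw [← cos_add_cos_eq]; ring
  rw [← hsym] at hadd
  have h2 : 2 * (∑ k : Tor L, gres L lam2 k ^ j * Real.cos (2 * Real.pi * k.1.val / L))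
      = ∑ k : Tor L, gres L lam2 k ^ j * (2 - epsT L k) := by linarith
  -- termwise: `g^j (2 − ε) = 2 g^j − ½ g^{j−1}(1 + λ g)` off `0`, and `0` at `k = 0`
  have hterm : ∀ k : Tor L, gres L lam2 k ^ j * (2 - epsT L k)
      = 2 * gres L lam2 k ^ j - (1 / 2) * (if k = 0 then 0 else gres L lam2 k ^ (j - 1)) - lam2 / 2 * gres L lam2 k ^ j := by
    intro k
    by_cases hk : k = 0
    · subst hk
      have : gres L lam2 0 = 0 := by unfold gres; simp
      rw [this, zero_pow (by omega)]; simp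
    · rw [if_neg hk]
      obtain ⟨i, rfl⟩ : ∃ i, j = i + 1 := ⟨j - 1, by omega⟩
      rw [Nat.add_sub_cancel, pow_succ]
      have hE := two_epsT_mul_gres L lam2 k hk (hne k hk)
      have : gres L lam2 k ^ i * gres L lam2 k * (2 - epsT L k)
          = gres L lam2 k ^ i * (2 * gres L lam2 k - (2 * epsT L k * gres L lam2 k) / 2) := by ring
      rw [this, hE]; ring
  rw [Finset.sum_congr rfl (fun k _ => hterm k), Finset.sum_sub_distrib, Finset.sum_sub_distrib,
    ← Finset.mul_sum, ← Finset.mul_sum, ← Finset.mul_sum] at h2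
  rw [Finset.sum_ite, Finset.sum_const_zero, zero_add, Finset.filter_ne'] at h2
  linarith

end KT1Assembly

end Summit.HubbardSuperconductivity.HubbardSuperconductivity.Theorems.AnisotropyChord.Transfer.Fibre3

end
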